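import Mathlib
import HarnessLib
import Literature.RingTheory.CohomologyAnnihilator.SyzygyBaseChange
import Summits.ResolutionOfSingularities.ResolutionOfSingularities.Theorems.HomologicalConductorPersistenceFrobeniusOrderSyzygy

/-!
# The Frobenius-order all-levels device AFTER A FLAT BASE CHANGE (localisation): the shape the
# K-C3 assembly consumes at the local ring `T₁ = loc O W`

Route `ResolutionOfSingularities/HomologicalConductor`, chain W4.4b, crux `Persistence`
(stmt-ResolutionOfSingularities-16484), KILL CANDIDATE K-C3 (res-L1-w44b-plan-1 ASSIGN v1.9).
[OURS · L1 w44b · res-D-pv-037 gen 9; AI-written and AI-reviewed only (weaker than expert review); NOT a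
statement of the manuscript under study, and no statement of that manuscript is used.]

`Theorems/HomologicalConductorPersistenceFrobeniusOrderSyzygy.lean` proves: a lattice `L` over a
Frobenius order `Λ/P` is an `n`-th syzygy for every `n`, so «`x` not stably annihilating `L` ⇒
`x ∉ caⁿ(Λ)` for all `n`».  The K-C3 kill needs this at the LOCAL ring `T₁ = loc O W = W_𝔪`, while the
Frobenius data (res-D-pv-058's U15: `W` free over `P₀ = k[a⁶,b³,c²]` on `1, a⁴b, a²b², a³c, abc, a⁵b²c`,
`τ` = coefficient of `a⁵b²c`) and the witness `X_b` live over the GLOBAL ring `W`.  This file bridges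
the two WITHOUT asking anyone to exhibit `T₁` itself as a Frobenius order: syzygy chains base-change
along any FLAT algebra `Λ → Λ'` (tree `IsSyzygy.baseChange`, [IyengarTakahashi2014] proof of Thm 5.4),
in particular along a localisation.

* `forall_exists_isSyzygy_baseChange` — if `L` is an `n`-th syzygy of a finitely generated `Λ`-module
  for every `n`, then so is `Λ' ⊗_Λ L` over any flat `Λ`-algebra `Λ'`.
* `not_mem_cohomologyAnnihilatorOfDegree_of_forall_isSyzygy_baseChange` — hence, for `Λ'` noetherian,
  `¬ StablyAnnihilates Λ' x (Λ' ⊗_Λ L) → x ∉ caⁿ(Λ')` for every `n`.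
* **`not_mem_cohomologyAnnihilatorOfDegree_of_frobeniusOrder_baseChange`** /
  **`not_mem_cohomologyAnnihilator_of_frobeniusOrder_baseChange`** (basis form): `Λ` a Frobenius
  order over `P` (two `P`-bases `b`, `b∨`, `τ(bᵢ b∨ⱼ) = δᵢⱼ`), `L` finitely generated over `Λ` and
  projective over `P`, `Λ'` a flat noetherian `Λ`-algebra, `x ∈ Λ'` NOT stably annihilating
  `Λ' ⊗_Λ L` ⇒ `x ∉ caⁿ(Λ')` for every `n` and `x ∉ ca(Λ')`.
* `…_of_frobeniusOrder_isLocalization` — the same with `Λ'` a localisation of `Λ` (flat by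
  `IsLocalization.flat`).

**K5 instantiation (res-D-pv-026's successor):** `Λ := W` (any presentation carrying U15's bases over
`P := P₀`), `Λ' := ↥(loc O W) = T₁` with `IsLocalization (W ∖ 𝔪_W) T₁` (res-D-pv-043's `mem_loc_iff` /
the tree's `isLocalization_locAt`), `L := X_b` (free over `P₀` — the MCM obligation), `x := a⁶ ∈ T₁`,
`hx :=` K4(c) (res-D-pv-058, `T₁ ⊗_W X_b ≅ coker(D ⊗ T₁)` up to `StablyAnnihilates.of_iso`).
Output: `a⁶ ∉ ca(T₁)`, with no `hGor`.

References (mechanism only): S. B. Iyengar, R. Takahashi, IMRN 2016 (arXiv:1404.1476) §2 and proof of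
Thm 5.4 [`IyengarTakahashi2014`]; F. Kasch, Math. Ann. 127 (1954).
-/

noncomputable section

-- single-problem summit: the doubled namespace component `ResolutionOfSingularities` is forced
set_option linter.dupNamespace false

namespace Summit.ResolutionOfSingularities.ResolutionOfSingularities.Theorems.HomologicalConductor.FrobeniusOrderSyzygy

open CategoryTheory TensorProduct Literature.RingTheory.CohomologyAnnihilator
open Summit.ResolutionOfSingularities.ResolutionOfSingularities.Theorems.NoZeno.SandwichCluster

universe u

section BaseChange

variable {Λ : Type u} [CommRing Λ] (Λ' : Type u) [CommRing Λ'] [Algebra Λ Λ']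
variable (L : Type u) [AddCommGroup L] [Module Λ L]

/-- **Infinite syzygies base-change along flat algebras.** If `L` is, for every `n`, an `n`-th syzygy
of some finitely generated `Λ`-module, then `Λ' ⊗_Λ L` is, for every `n`, an `n`-th syzygy of some
finitely generated `Λ'`-module, for any flat `Λ`-algebra `Λ'` (tree `IsSyzygy.baseChange`).
[cite: IyengarTakahashi2014, proof of Theorem 5.4] -/
theorem forall_exists_isSyzygy_baseChange [Module.Flat Λ Λ']
    (hL : ∀ n : ℕ, ∃ M : ModuleCat.{u} Λ, Module.Finite Λ M ∧ IsSyzygy n M (ModuleCat.of Λ L))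
    (n : ℕ) : ∃ M' : ModuleCat.{u} Λ', Module.Finite Λ' M' ∧
      IsSyzygy n M' (ModuleCat.of Λ' (Λ' ⊗[Λ] L)) := by
  obtain ⟨M, hM, hMK⟩ := hL n
  haveI := hM
  exact ⟨ModuleCat.of Λ' (Λ' ⊗[Λ] M), inferInstance, IsSyzygy.baseChange Λ' n hMK⟩

/-- **The infinite-syzygy device after a flat base change.** `Λ'` a flat noetherian `Λ`-algebra, `L` an
infinite syzygy over `Λ` (an `n`-th syzygy of a finitely generated module for every `n`); if `x ∈ Λ'`
does not stably annihilate `Λ' ⊗_Λ L`, then `x ∉ caⁿ(Λ')` for every `n`. [OURS · L1 w44b] -/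
theorem not_mem_cohomologyAnnihilatorOfDegree_of_forall_isSyzygy_baseChange [Module.Flat Λ Λ']
    [IsNoetherianRing Λ']
    (hL : ∀ n : ℕ, ∃ M : ModuleCat.{u} Λ, Module.Finite Λ M ∧ IsSyzygy n M (ModuleCat.of Λ L))
    {x : Λ'} (hx : ¬ StablyAnnihilates Λ' x (ModuleCat.of Λ' (Λ' ⊗[Λ] L))) (n : ℕ) :
    x ∉ cohomologyAnnihilatorOfDegree Λ' n :=
  not_mem_cohomologyAnnihilatorOfDegree_of_forall_isSyzygy
    (forall_exists_isSyzygy_baseChange Λ' L hL) hx n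

variable {P : Type u} [CommRing P] [Algebra P Λ] [Module P L] [IsScalarTower P Λ L]
variable {ι : Type} [Fintype ι] [DecidableEq ι] {τ : Λ →ₗ[P] P}

/-- **The all-levels device for a Frobenius order, after a flat base change** (levelled).  `Λ` a
Frobenius order over `P` in basis form (two `P`-bases `b`, `b∨` of `Λ` with `τ(bᵢ b∨ⱼ) = δᵢⱼ` for a
`P`-linear `τ`), `L` finitely generated over `Λ` and projective over `P`, `Λ'` a flat noetherian
`Λ`-algebra; if `x ∈ Λ'` does NOT stably annihilate `Λ' ⊗_Λ L`, then `x ∉ caⁿ(Λ')` for every `n`.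
The K-C3 instance: `Λ = W` with U15's bases over `P₀ = k[a⁶,b³,c²]`, `Λ' = T₁ = loc O W`, `L = X_b`,
`x = a⁶`. [OURS · L1 w44b] -/
theorem not_mem_cohomologyAnnihilatorOfDegree_of_frobeniusOrder_baseChange [Module.Flat Λ Λ']
    [IsNoetherianRing Λ'] (β βd : Module.Basis ι P Λ)
    (hG : ∀ i j, τ (β i * βd j) = if i = j then 1 else 0)
    [Module.Finite Λ L] [Module.Projective P L] {x : Λ'}
    (hx : ¬ StablyAnnihilates Λ' x (ModuleCat.of Λ' (Λ' ⊗[Λ] L))) (n : ℕ) :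
    x ∉ cohomologyAnnihilatorOfDegree Λ' n := by
  haveI : Module.Finite P Λ := Module.Finite.of_basis β
  haveI : Module.Projective P Λ := Module.Projective.of_basis β
  obtain ⟨h₁, h₂⟩ := dualBases_of_basis (τ := τ) β βd hG
  exact not_mem_cohomologyAnnihilatorOfDegree_of_forall_isSyzygy_baseChange Λ' L
    (fun m => exists_isSyzygy_of_projective h₁ h₂ m L) hx n

/-- **The all-levels device for a Frobenius order, after a flat base change** (`ca` form): under the
hypotheses of the previous theorem, `x ∉ ca(Λ')`.  This is the statement that replaces the named fact
`hGor` in the K-C3 assembly `not_persistence (hE) (hca)`. [OURS · L1 w44b] -/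
theorem not_mem_cohomologyAnnihilator_of_frobeniusOrder_baseChange [Module.Flat Λ Λ']
    [IsNoetherianRing Λ'] (β βd : Module.Basis ι P Λ)
    (hG : ∀ i j, τ (β i * βd j) = if i = j then 1 else 0)
    [Module.Finite Λ L] [Module.Projective P L] {x : Λ'}
    (hx : ¬ StablyAnnihilates Λ' x (ModuleCat.of Λ' (Λ' ⊗[Λ] L))) :
    x ∉ cohomologyAnnihilator Λ' := by
  rw [mem_cohomologyAnnihilator_iff]
  rintro ⟨n, hn⟩
  exact not_mem_cohomologyAnnihilatorOfDegree_of_frobeniusOrder_baseChange Λ' L β βd hG hx n hn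

/-- **Localised form.** `Λ'` a localisation of the Frobenius order `Λ` (hence flat), `Λ'` noetherian:
`¬ StablyAnnihilates Λ' x (Λ' ⊗_Λ L) → x ∉ caⁿ(Λ')` for every `n` — the K-C3 shape with
`Λ' = T₁ = W[(W ∖ 𝔪_W)⁻¹]`. [OURS · L1 w44b] -/
theorem not_mem_cohomologyAnnihilatorOfDegree_of_frobeniusOrder_isLocalization (S : Submonoid Λ)
    [IsLocalization S Λ'] [IsNoetherianRing Λ'] (β βd : Module.Basis ι P Λ)
    (hG : ∀ i j, τ (β i * βd j) = if i = j then 1 else 0)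
    [Module.Finite Λ L] [Module.Projective P L] {x : Λ'}
    (hx : ¬ StablyAnnihilates Λ' x (ModuleCat.of Λ' (Λ' ⊗[Λ] L))) (n : ℕ) :
    x ∉ cohomologyAnnihilatorOfDegree Λ' n := by
  haveI : Module.Flat Λ Λ' := IsLocalization.flat Λ' S
  exact not_mem_cohomologyAnnihilatorOfDegree_of_frobeniusOrder_baseChange Λ' L β βd hG hx n

/-- **Localised form, `ca`:** under the hypotheses of the previous theorem, `x ∉ ca(Λ')`.
[OURS · L1 w44b] -/
theorem not_mem_cohomologyAnnihilator_of_frobeniusOrder_isLocalization (S : Submonoid Λ)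
    [IsLocalization S Λ'] [IsNoetherianRing Λ'] (β βd : Module.Basis ι P Λ)
    (hG : ∀ i j, τ (β i * βd j) = if i = j then 1 else 0)
    [Module.Finite Λ L] [Module.Projective P L] {x : Λ'}
    (hx : ¬ StablyAnnihilates Λ' x (ModuleCat.of Λ' (Λ' ⊗[Λ] L))) :
    x ∉ cohomologyAnnihilator Λ' := by
  haveI : Module.Flat Λ Λ' := IsLocalization.flat Λ' S
  exact not_mem_cohomologyAnnihilator_of_frobeniusOrder_baseChange Λ' L β βd hG hx

end BaseChange

end Summit.ResolutionOfSingularities.ResolutionOfSingularities.Theorems.HomologicalConductor.FrobeniusOrderSyzygy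

end
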